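import Literature.NumberTheory.Automorphic.BrandtEichlerLevelUOperators
import Literature.NumberTheory.Automorphic.BrandtModuleWeightSymmProofs
import Literature.NumberTheory.Automorphic.EichlerSubidealCount
import Literature.NumberTheory.Automorphic.BrandtMatrixRamifiedEigenspaces
import Mathlib.LinearAlgebra.Matrix.Permutation
import HarnessLib

/-!
# Route `RamifiedHeegnerPair`, crux U₁ `LeafRankOneUpperAtThree` (stmt-BirchSwinnertonDyer-26022), line `partnerdescent` —
# partner kernel, base change (α) part 12: the Hecke–Atkin–Lehner twist (HT) REDUCED to its print core — the `U`-operators at the level primes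

HONEST FRAMING. Theorems only; helper file (`--supports stmt-BirchSwinnertonDyer-26022 --as helper`); linear algebra over the tree's Brandt layer
(‹BrandtEichlerLevelUOperators› `S.heckeAt`, `S.uMatrix`; ‹BrandtModuleWeightSymmProofs› `weight_mul_matrix_symm`; ‹EichlerSubidealCount›
`sum_matrix_prime_eq`; Mathlib `Equiv.Perm.permMatrix`); no number theory, no named fact, no `sorry`; nothing booked; BSD is proved for no curve.
Lead prover bsd-line-rhp-p2 g64, 2026-08-31.

WHY. The stub HECKE-MODULE of skeleton v10 (`Partnerdescent.LeafHeckeModuleInputsAtThree`) has as first conjunct (HT): an integral twist `W₁`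
(inverse `W₂`) of `ℤ^{Cls O}`, degree-preserving, commuting with the good Brandt matrices, such that every canonical Hecke generator
`S.heckeAt q` is self-adjoint for Gross's pairing twisted by `W₁` (`(heckeAt q)ᵀ·(D_w W₁) = (D_w W₁)·heckeAt q`) and degree-preserving. For the
intended twist — the permutation matrix `P_σ` of an involution `σ` of `Cls O` preserving the weights and the Brandt matrices
(`T(n)_{σc,σc′} = T(n)_{cc′}`: the composite of the tree's Atkin–Lehner involutions `S.wPlus ℓ`, `ℓ ∣ pM`, by ‹BrandtSetupAtkinLehnerInvolutions›
`involutive_wPlus`, `wPlus_comm`, `weight_wPlus` and ‹BrandtSetupAtkinLehnerHecke› `matrix_apply_wPlus_wPlus`) — EVERYTHING in (HT) about the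
Brandt matrices `T(q) = heckeAt q` (`q ∤ N⁺`) is TREE: weight symmetry, commutation with `P_σ`, column sums `q + 1` at the good primes. What remains
is print about the `U`-operators `S.uMatrix ℓ = heckeAt ℓ` at `ℓ ∣ N⁺` (their `P_σ`-twisted adjointness `U_ℓ† = σ U_ℓ σ⁻¹` and their column sums)
— the ramified `T(q)`, `q ∣ N⁻`, being permutation matrices (‹BrandtMatrixRamifiedEigenspaces›), preserve degree zero (proved here).
`heckeTwist_of_involution`: (HT) from `σ` and these `U`/ramified inputs. [cite: Mazur1977, II §15] [cite: WZhang2014, §3.9 p. 214]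
[cite: BertoliniDarmon1996, §1.5] [cite: Gross1987, §1–§2]
-/

set_option linter.dupNamespace false
set_option autoImplicit false

noncomputable section

namespace Summit.BirchSwinnertonDyer.BirchSwinnertonDyer.Theorems.LeafPartnerOrders

open Matrix Literature.NumberTheory.Automorphic Literature.NumberTheory.Automorphic.Brandt

variable {Nplus Nminus : ℕ} (S : XiSetup Nplus Nminus) [Fintype (ClassSet S.O)] [DecidableEq (ClassSet S.O)]

/-- The permutation matrix of an involution acts by `v ↦ v ∘ σ` and squares to `1`. [folklore] -/
theorem permMatrix_involutive_mul_self {ι : Type*} [Fintype ι] [DecidableEq ι] {σ : ι → ι} (hσ : Function.Involutive σ) :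
    (hσ.toPerm σ).permMatrix ℤ * (hσ.toPerm σ).permMatrix ℤ = 1 := by
  rw [← Matrix.permMatrix_mul]
  have : hσ.toPerm σ * hσ.toPerm σ = 1 := Equiv.ext fun c ↦ hσ c
  rw [this, Matrix.permMatrix_one]

omit [DecidableEq (ClassSet S.O)] in
/-- `T(n) (v ∘ σ) = (T(n) v) ∘ σ` for an involution `σ` preserving the Brandt matrix `T(n)`. [cite: BertoliniDarmon1996, §1.5] -/
theorem mulVec_comp_of_involutive' {σ : ClassSet S.O → ClassSet S.O} (hσ : Function.Involutive σ) (n : ℕ)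
    (hT : ∀ c d, Brandt.matrix S.O n (σ c) (σ d) = Brandt.matrix S.O n c d) (v : ClassSet S.O → ℤ) :
    Brandt.matrix S.O n *ᵥ (v ∘ σ) = (Brandt.matrix S.O n *ᵥ v) ∘ σ := by
  funext c
  simp only [Matrix.mulVec, dotProduct, Function.comp_apply]
  have h1 : ∑ d, Brandt.matrix S.O n (σ c) (σ d) * v (σ d) = ∑ d, Brandt.matrix S.O n (σ c) d * v d :=
    Fintype.sum_bijective σ hσ.bijective (fun d ↦ Brandt.matrix S.O n (σ c) (σ d) * v (σ d)) _ fun _ ↦ rfl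
  rw [← h1]
  exact Finset.sum_congr rfl fun d _ ↦ by rw [hT]

/-- **The ramified Brandt matrix `T(q)`, `q ∣ N⁻`, preserves degree zero**: it is the permutation matrix of `W_{q⁻}`
(‹BrandtMatrixRamifiedEigenspaces› `map_matrix_ramified_eq_permMatrix_of_dvd`). [cite: VignerasLNM800, Ch. III §5 exercice 5.8 (b)] -/
theorem sum_mulVec_ramified_eq_zero {q : ℕ} (hq : q.Prime) (hqN : q ∣ Nminus) (v : ClassSet S.O → ℤ) (hv : ∑ c, v c = 0) :
    ∑ c, (Brandt.matrix S.O q *ᵥ v) c = 0 := by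
  haveI : Fact q.Prime := ⟨hq⟩
  have h := S.map_matrix_ramified_eq_permMatrix_of_dvd hqN (R := ℤ)
  have hid : (Brandt.matrix S.O q).map (Int.cast : ℤ → ℤ) = Brandt.matrix S.O q := by
    ext i j; simp
  rw [hid] at h
  rw [h, Matrix.permMatrix_mulVec]
  simp only [Function.comp_apply, Function.Involutive.coe_toPerm]
  rw [show ∑ c, v (S.wMinus q hqN c) = ∑ c, v c from
    Fintype.sum_bijective _ (S.involutive_wMinus hqN).bijective _ _ fun _ ↦ rfl]
  exact hv

/-- **(HT) from an Atkin–Lehner-type involution and the `U`-operator inputs.** Let `σ` be an involution of `Cls O` preserving every Brandt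
matrix (`T(n)_{σc,σd} = T(n)_{cd}`; the weights play no role for the `T(q)`), `P = P_σ` its permutation matrix (`P v = v ∘ σ`). Suppose (print inputs): every
`U`-operator `S.uMatrix ℓ` (`ℓ ∣ N⁺` prime) satisfies `U_ℓᵀ·(D_w P) = (D_w P)·U_ℓ` and preserves degree zero (the ramified `T(q)`,
`q ∣ N⁻`, do so by `sum_mulVec_ramified_eq_zero`). Then (HT) holds with `W₁ = W₂ = P`: `P² = 1`, `P` degree-preserving, `P T(q) = T(q) P` at the good primes, and
EVERY canonical generator `S.heckeAt q` is `P`-twisted self-adjoint and degree-preserving (for `q ∤ N⁺`: weight symmetry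
`Brandt.XiSetup.weight_mul_matrix_symm`, commutation, column sums `Brandt.XiSetup.sum_matrix_prime_eq`). The conclusion is VERBATIM the first
conjunct (HT) of `Partnerdescent.LeafHeckeModuleInputsAtThree` at a setup of type `(N⁺, N⁻) = (pM, d)`. [cite: Mazur1977, II §15]
[cite: WZhang2014, §3.9 p. 214] [cite: BertoliniDarmon1996, §1.5] [cite: Gross1987, §1–§2] -/
theorem heckeTwist_of_involution {σ : ClassSet S.O → ClassSet S.O} (hσ : Function.Involutive σ)
    (hT : ∀ (n : ℕ) (c d : ClassSet S.O), Brandt.matrix S.O n (σ c) (σ d) = Brandt.matrix S.O n c d)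
    (huadj : ∀ q : ℕ, q.Prime → q ∣ Nplus →
      (S.uMatrix q)ᵀ * (Matrix.diagonal (fun c ↦ (weight S.O c : ℤ)) * (hσ.toPerm σ).permMatrix ℤ) =
        (Matrix.diagonal (fun c ↦ (weight S.O c : ℤ)) * (hσ.toPerm σ).permMatrix ℤ) * S.uMatrix q)
    (hudeg : ∀ q : ℕ, q.Prime → q ∣ Nplus → ∀ v : ClassSet S.O → ℤ, ∑ c, v c = 0 → ∑ c, (S.uMatrix q *ᵥ v) c = 0) :
    ∃ (W₁ W₂ : Matrix (ClassSet S.O) (ClassSet S.O) ℤ),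
      W₁ * W₂ = 1 ∧ W₂ * W₁ = 1 ∧
      (∀ v : ClassSet S.O → ℤ, ∑ c, v c = 0 → ∑ c, (W₁ *ᵥ v) c = 0) ∧
      (∀ v : ClassSet S.O → ℤ, ∑ c, v c = 0 → ∑ c, (W₂ *ᵥ v) c = 0) ∧
      (∀ q : ℕ, q.Prime → ¬ q ∣ Nplus * Nminus → W₁ * Brandt.matrix S.O q = Brandt.matrix S.O q * W₁) ∧
      (∀ q : ℕ, q.Prime → (S.heckeAt q)ᵀ * (Matrix.diagonal (fun c ↦ (weight S.O c : ℤ)) * W₁) =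
        (Matrix.diagonal (fun c ↦ (weight S.O c : ℤ)) * W₁) * S.heckeAt q) ∧
      (∀ q : ℕ, q.Prime → ∀ v : ClassSet S.O → ℤ, ∑ c, v c = 0 → ∑ c, (S.heckeAt q *ᵥ v) c = 0) := by
  set P : Matrix (ClassSet S.O) (ClassSet S.O) ℤ := (hσ.toPerm σ).permMatrix ℤ with hPdef
  have hPv : ∀ v : ClassSet S.O → ℤ, P *ᵥ v = v ∘ σ := fun v ↦ Matrix.permMatrix_mulVec _
  have hPP : P * P = 1 := permMatrix_involutive_mul_self hσ
  have hPdeg : ∀ v : ClassSet S.O → ℤ, ∑ c, v c = 0 → ∑ c, (P *ᵥ v) c = 0 := by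
    intro v hv
    rw [hPv]
    rw [show ∑ c, (v ∘ σ) c = ∑ c, v c from Fintype.sum_bijective σ hσ.bijective _ _ fun _ ↦ rfl]
    exact hv
  -- `P` commutes with every Brandt matrix
  have hPT : ∀ n : ℕ, P * Brandt.matrix S.O n = Brandt.matrix S.O n * P := by
    intro n
    apply Matrix.toLin'.injective
    apply LinearMap.ext
    intro v
    rw [Matrix.toLin'_apply, Matrix.toLin'_apply, ← mulVec_mulVec, ← mulVec_mulVec, hPv, hPv,
      mulVec_comp_of_involutive' S hσ n (hT n)]
  -- weight symmetry as a matrix identity: `T(n)ᵀ D = D T(n)`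
  have hsymm : ∀ n : ℕ, (Brandt.matrix S.O n)ᵀ * Matrix.diagonal (fun c ↦ (weight S.O c : ℤ)) =
      Matrix.diagonal (fun c ↦ (weight S.O c : ℤ)) * Brandt.matrix S.O n := by
    intro n
    ext i j
    rw [Matrix.mul_diagonal, Matrix.diagonal_mul, Matrix.transpose_apply, mul_comm]
    exact (S.weight_mul_matrix_symm n i j).symm
  -- column sums at the good primes
  have hgooddeg : ∀ q : ℕ, q.Prime → ¬ q ∣ Nplus * Nminus → ∀ v : ClassSet S.O → ℤ, ∑ c, v c = 0 →
      ∑ c, (Brandt.matrix S.O q *ᵥ v) c = 0 := by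
    intro q hq hqN v hv
    calc ∑ c, (Brandt.matrix S.O q *ᵥ v) c = ∑ d, (∑ c, Brandt.matrix S.O q c d) * v d := by
          simp only [mulVec, dotProduct, Finset.sum_mul]
          rw [Finset.sum_comm]
      _ = ∑ d, ((q : ℤ) + 1) * v d := Finset.sum_congr rfl fun d _ ↦ by rw [S.sum_matrix_prime_eq hq hqN d]
      _ = 0 := by rw [← Finset.mul_sum, hv, mul_zero]
  refine ⟨P, P, hPP, hPP, hPdeg, hPdeg, fun q _ _ ↦ hPT q, fun q hq ↦ ?_, fun q hq v hv ↦ ?_⟩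
  · -- twisted self-adjointness of `heckeAt q`
    by_cases hqN : q ∣ Nplus
    · rw [S.heckeAt_of_dvd hqN]; exact huadj q hq hqN
    · rw [S.heckeAt_of_not_dvd hqN, ← Matrix.mul_assoc, hsymm q, Matrix.mul_assoc, ← hPT q, Matrix.mul_assoc]
  · -- degree preservation of `heckeAt q`
    by_cases hqN : q ∣ Nplus
    · rw [S.heckeAt_of_dvd hqN]; exact hudeg q hq hqN v hv
    · rw [S.heckeAt_of_not_dvd hqN]
      by_cases hqM : q ∣ Nminus
      · exact sum_mulVec_ramified_eq_zero S hq hqM v hv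
      · exact hgooddeg q hq (fun h ↦ (Nat.Prime.dvd_mul hq).mp h |>.elim hqN hqM) v hv

end Summit.BirchSwinnertonDyer.BirchSwinnertonDyer.Theorems.LeafPartnerOrders

end
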